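import Mathlib

/-!
# The side-pairing inequality (blind cell PercRepro2, p3 g17, 2026-08-27; `proofs/P3-CPNC.md` §14i Step 4)

The combinatorial heart of the fully-attached-region theorem of §14i: the components of a region are
split into two sides `S` and `Sᶜ`; `V` is the (non-empty) set of components carrying an `r–s` path in
their own colour; `h S` is the hub-help of the components in `S`, increasing in `S`.  Then

  `∑_{S : S ∩ V ≠ ∅} (h Sᶜ − h S) ≤ 0`.

Proof: reindex the first term by complementation (`S ↦ Sᶜ` is an involution of the subsets, and
`S ∩ V ≠ ∅ ⟺ V ⊄ Sᶜ`), so the sum equals `∑_S h S · (1[V ⊄ S] − 1[S ∩ V ≠ ∅]) = ∑_{S ∩ V = ∅} h S − ∑_{V ⊆ S} h S`,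
and `S ↦ S ∪ V` is a bijection from `{S ∩ V = ∅}` onto `{V ⊆ S}` along which `h` does not decrease.
Own work; std axioms.
-/

namespace Summit.Ventures.PercRepro2

namespace SidePairing

open Finset

variable {α : Type*} [DecidableEq α] [Fintype α]

/-- Complementation as a permutation of the subsets. -/
def complPerm : Equiv.Perm (Finset α) := Function.Involutive.toPerm compl compl_compl

/-- Reindexing a sum over all subsets by complementation. -/
lemma sum_compl (f : Finset α → ℤ) : ∑ S : Finset α, f Sᶜ = ∑ S : Finset α, f S :=
  Fintype.sum_equiv (complPerm (α := α)) _ _ (fun _ => rfl)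

/-- `S ∩ V ≠ ∅ ⟺ V ⊄ Sᶜ`. -/
lemma inter_nonempty_iff_not_subset_compl (S V : Finset α) :
    (S ∩ V).Nonempty ↔ ¬ V ⊆ Sᶜ := by
  constructor
  · rintro ⟨x, hx⟩ hVS
    have := hVS (mem_inter.1 hx).2
    exact (mem_compl.1 this) (mem_inter.1 hx).1
  · intro h
    by_contra hne
    apply h
    intro x hxV
    rw [mem_compl]
    intro hxS
    exact hne ⟨x, mem_inter.2 ⟨hxS, hxV⟩⟩

/-- The union with `V` is a bijection from the subsets disjoint from `V` onto the supersets of `V`. -/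
lemma image_union_eq (V : Finset α) :
    ((univ : Finset (Finset α)).filter (fun S => S ∩ V = ∅)).image (fun S => S ∪ V) =
      (univ : Finset (Finset α)).filter (fun S => V ⊆ S) := by
  ext T
  simp only [mem_image, mem_filter, mem_univ, true_and]
  constructor
  · rintro ⟨S, _, rfl⟩
    exact subset_union_right
  · intro hVT
    refine ⟨T \ V, ?_, ?_⟩
    · ext x; simp
    · ext x
      simp only [mem_union, mem_sdiff]
      constructor
      · rintro (⟨hx, _⟩ | hx)
        · exact hx
        · exact hVT hx
      · intro hx
        by_cases hxV : x ∈ V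
        · exact Or.inr hxV
        · exact Or.inl ⟨hx, hxV⟩

/-- `S ↦ S ∪ V` is injective on the subsets disjoint from `V`. -/
lemma union_injOn (V : Finset α) :
    Set.InjOn (fun S : Finset α => S ∪ V)
      ↑((univ : Finset (Finset α)).filter (fun S => S ∩ V = ∅)) := by
  intro S hS T hT hST
  simp only [coe_filter, mem_univ, true_and, Set.mem_setOf_eq] at hS hT
  have key : ∀ {A : Finset α}, A ∩ V = ∅ → (A ∪ V) \ V = A := by
    intro A hA
    ext x
    simp only [mem_sdiff, mem_union]
    constructor
    · rintro ⟨hx | hx, hxV⟩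
      · exact hx
      · exact absurd hx hxV
    · intro hx
      refine ⟨Or.inl hx, fun hxV => ?_⟩
      have : x ∈ A ∩ V := mem_inter.2 ⟨hx, hxV⟩
      rw [hA] at this
      exact absurd this (notMem_empty x)
  calc S = (S ∪ V) \ V := (key hS).symm
    _ = (T ∪ V) \ V := by simp only at hST; rw [hST]
    _ = T := key hT

/-- **The side-pairing inequality**: for a non-empty `V` and an increasing `h`,
`∑_{S : S ∩ V ≠ ∅} (h Sᶜ − h S) ≤ 0`. -/
theorem sum_compl_sub_nonpos (V : Finset α) (hV : V.Nonempty) (h : Finset α → ℤ)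
    (hmono : ∀ S T : Finset α, S ⊆ T → h S ≤ h T) :
    ∑ S : Finset α, (if (S ∩ V).Nonempty then h Sᶜ - h S else 0) ≤ 0 := by
  -- split into the two sums and reindex the first by complementation
  have hsplit : ∀ S : Finset α,
      (if (S ∩ V).Nonempty then h Sᶜ - h S else 0) =
        (if (S ∩ V).Nonempty then h Sᶜ else 0) - (if (S ∩ V).Nonempty then h S else 0) := by
    intro S; split_ifs <;> simp
  rw [Finset.sum_congr rfl (fun S _ => hsplit S), Finset.sum_sub_distrib]
  have hre : ∑ S : Finset α, (if (S ∩ V).Nonempty then h Sᶜ else 0) =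
      ∑ S : Finset α, (if ¬ V ⊆ S then h S else 0) := by
    rw [← sum_compl (fun S => if ¬ V ⊆ S then h S else 0)]
    refine Finset.sum_congr rfl (fun S _ => ?_)
    simp only [inter_nonempty_iff_not_subset_compl]
  rw [hre, ← Finset.sum_sub_distrib]
  -- the pointwise indicator identity: `1[V ⊄ S] − 1[S ∩ V ≠ ∅] = 1[S ∩ V = ∅] − 1[V ⊆ S]`
  have hpt : ∀ S : Finset α,
      ((if ¬ V ⊆ S then h S else 0) - (if (S ∩ V).Nonempty then h S else 0)) =
        (if S ∩ V = ∅ then h S else 0) - (if V ⊆ S then h S else 0) := by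
    intro S
    by_cases h1 : V ⊆ S
    · have h2 : (S ∩ V).Nonempty := by
        obtain ⟨x, hx⟩ := hV
        exact ⟨x, mem_inter.2 ⟨h1 hx, hx⟩⟩
      have h3 : ¬ S ∩ V = ∅ := Finset.nonempty_iff_ne_empty.1 h2
      simp [h1, h2, h3]
    · by_cases h2 : (S ∩ V).Nonempty
      · have h3 : ¬ S ∩ V = ∅ := Finset.nonempty_iff_ne_empty.1 h2
        simp [h1, h2, h3]
      · have h3 : S ∩ V = ∅ := Finset.not_nonempty_iff_eq_empty.1 h2
        simp [h1, h3]
  rw [Finset.sum_congr rfl (fun S _ => hpt S), Finset.sum_sub_distrib, sub_nonpos]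
  -- `∑_{S ∩ V = ∅} h S ≤ ∑_{V ⊆ S} h S` by the injection `S ↦ S ∪ V`
  rw [← Finset.sum_filter, ← Finset.sum_filter, ← image_union_eq V,
    Finset.sum_image (fun S hS T hT hST => union_injOn V hS hT hST)]
  refine Finset.sum_le_sum (fun S _ => hmono S (S ∪ V) subset_union_left)

end SidePairing

end Summit.Ventures.PercRepro2
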